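import Summits.MatrixMultiplication.OmegaCensus.STPPVosperSlackTwoLawAB
import Summits.MatrixMultiplication.OmegaCensus.STPPVosperSlackTwoCheckersSound2
import Literature.Combinatorics.Additive.HamidouneRodsethAbelianPairs

/-!
# ω-census (abelian STPP census): the slack-2 law, cases A / B′ by rows UP TO THE DIHEDRAL SYMMETRY of the free shape (kernel tool + law)

HONEST FRAMING (pub-omega census; verbatim): lottery ticket; floor = certified bounds/negative ranges.
Census STRUCTURE (seat pub-omega-stpp-2 gen 27, 2026-08-28), family (b2).  The rows of `slack_two_caseC_of_rows` (`STPPVosperSlackTwoLawAB.lean`, stpp-1)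
range over ALL `b`-element value shapes `Q ∋ 0` of `ℤ/p` (`qShapes p b …`: 1 770 three-shapes, 34 220 four-shapes at `p = 61`).  The soundness theorem
`caseADeadQ'_false_of_isAP` already holds for EVERY base point `β₀ ∈ Bᵢ` (re-basing = translating the shape) and, since a progression of difference `d`
is one of difference `−d`, for both signs of the dilation (reflecting the shape).  So the rows need to hold only for ONE representative per dihedral
orbit `{u·(Bᵢ − β₀) : β₀ ∈ Bᵢ, u = ±d⁻¹}`.  We take the representative of SMALLEST BIT-MASK and test non-minimality inside the kernel:
* `rebaseMask p Q v` / `reflectMask p Q v` — the masks of `{(w − v) mod p}` / `{(v − w) mod p}` (`w ∈ Q`); `dihedralSmaller p Q` — some `v ∈ Q` gives a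
  smaller mask than `Q` itself (cost ≈ `2b` mask evaluations per shape; rejects 1 460 / 1 770 resp. 29 725 / 34 220 shapes at `p = 61`, leaving 310 / 4 495);
* soundness `exists_dihedralSmaller_false`: for `S ≠ ∅` and any `u` some `(x ∈ S, ε = ±1)` has `dihedralSmaller p (vals (εu) x S) = false`
  (`Finset.exists_min_image`; transport lemmas `rebaseMask_valShape`, `reflectMask_valShape` via `val_sub_eq_mod` and `tb_maskOf`);
* `IsAP.neg_diff` (`IsAP X d → IsAP X (−d)`, from `Isoperimetric.apFinset_eq_apFinset_neg`);
* **`slack_two_caseC_of_rowsQ`** — `slack_two_caseC_of_rows` with the row hypotheses weakened to `dihedralSmaller p Q = true ∨ caseADeadQ' … Q = true`;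
* chunk glue for row files: `forall_qShapes_append` (index ranges `lo ≤ mid ≤ hi`), `forall_drop_of_take_drop` (generic lists), `rowsQ_of_all`.
UNCONDITIONAL; no `decide`.  Nothing here is progress on `ω`.

References: H. Cohn, R. Kleinberg, B. Szegedy, C. Umans, FOCS 2005 (arXiv:math/0511460), Def. 5.1; A. G. Vosper, J. London Math. Soc. 31 (1956).
-/

open Finset
open scoped Pointwise

namespace Summit.MatrixMultiplication.OmegaCensus.CubeNB.S2

open Literature.Computability.AlgebraicComplexity
open Literature.Combinatorics.Additive
open Summit.MatrixMultiplication.OmegaCensus.STPPKneser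
open Summit.MatrixMultiplication.OmegaCensus.CubeNB.Bits

/-! ## §1 The dihedral non-minimality test (kernel) -/

/-- Mask of the re-based shape `{(w − v) mod p : w ∈ Q}`. [folklore] -/
def rebaseMask (p : ℕ) (Q : List ℕ) (v : ℕ) : ℕ := maskOf (Q.map fun w => (w + p - v) % p)

/-- Mask of the reflected shape `{(v − w) mod p : w ∈ Q}`. [folklore] -/
def reflectMask (p : ℕ) (Q : List ℕ) (v : ℕ) : ℕ := maskOf (Q.map fun w => (v + p - w) % p)

/-- **`Q` is not the minimal-mask representative of its dihedral orbit**: some re-basing or reflection at a point `v ∈ Q` has a smaller bit-mask.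
[folklore] -/
def dihedralSmaller (p : ℕ) (Q : List ℕ) : Bool :=
  Q.any fun v => Nat.blt (rebaseMask p Q v) (maskOf Q) || Nat.blt (reflectMask p Q v) (maskOf Q)

/-! ## §2 Soundness: every orbit has a representative passing the test -/

/-- Lists with the same members have the same mask. [folklore] -/
theorem maskOf_eq_of_mem_iff {l₁ l₂ : List ℕ} (h : ∀ x, x ∈ l₁ ↔ x ∈ l₂) : maskOf l₁ = maskOf l₂ := by
  refine Nat.eq_of_testBit_eq fun i => ?_
  rw [← tb_eq_testBit, ← tb_eq_testBit, Bool.eq_iff_iff, tb_maskOf, tb_maskOf]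
  exact h i

variable {p : ℕ} [hp : Fact p.Prime]

/-- Members of the value shape `((S.image fun x => (u·(x − x₀)).val).sort)`. [folklore] -/
theorem mem_valShape {S : Finset (ZMod p)} {u x₀ : ZMod p} {w : ℕ} :
    w ∈ ((S.image fun x => (u * (x - x₀)).val).sort (· ≤ ·)) ↔ ∃ y ∈ S, (u * (y - x₀)).val = w := by
  rw [Finset.mem_sort, mem_image]

/-- **Re-basing transport**: re-basing the value shape of `u·(S − x₀)` at the value of `x ∈ S` gives the mask of the value shape of `u·(S − x)`. [folklore] -/
theorem rebaseMask_valShape (S : Finset (ZMod p)) (u x₀ x : ZMod p) :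
    rebaseMask p (((S.image fun y => (u * (y - x₀)).val).sort (· ≤ ·))) (u * (x - x₀)).val =
      maskOf (((S.image fun y => (u * (y - x)).val).sort (· ≤ ·))) := by
  unfold rebaseMask
  refine maskOf_eq_of_mem_iff fun w => ?_
  rw [List.mem_map, mem_valShape]
  constructor
  · rintro ⟨w', hw', rfl⟩
    rw [mem_valShape] at hw'
    obtain ⟨y, hy, rfl⟩ := hw'
    refine ⟨y, hy, ?_⟩
    rw [val_sub_eq_mod]; congr 1; ring
  · rintro ⟨y, hy, rfl⟩
    refine ⟨(u * (y - x₀)).val, mem_valShape.2 ⟨y, hy, rfl⟩, ?_⟩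
    rw [val_sub_eq_mod]; congr 1; ring

/-- **Reflection transport**: reflecting the value shape of `u·(S − x₀)` at the value of `x ∈ S` gives the mask of the value shape of `(−u)·(S − x)`. [folklore] -/
theorem reflectMask_valShape (S : Finset (ZMod p)) (u x₀ x : ZMod p) :
    reflectMask p (((S.image fun y => (u * (y - x₀)).val).sort (· ≤ ·))) (u * (x - x₀)).val =
      maskOf (((S.image fun y => (-u * (y - x)).val).sort (· ≤ ·))) := by
  unfold reflectMask
  refine maskOf_eq_of_mem_iff fun w => ?_
  rw [List.mem_map, mem_valShape]
  constructor
  · rintro ⟨w', hw', rfl⟩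
    rw [mem_valShape] at hw'
    obtain ⟨y, hy, rfl⟩ := hw'
    refine ⟨y, hy, ?_⟩
    rw [val_sub_eq_mod]; congr 1; ring
  · rintro ⟨y, hy, rfl⟩
    refine ⟨(u * (y - x₀)).val, mem_valShape.2 ⟨y, hy, rfl⟩, ?_⟩
    rw [val_sub_eq_mod]; congr 1; ring

/-- **Every dihedral orbit has a minimal-mask representative**: for `S ≠ ∅` and any `u`, some base point `x ∈ S` and sign `ε = ±1` give a value shape
on which `dihedralSmaller` fails. [folklore] -/
theorem exists_dihedralSmaller_false {S : Finset (ZMod p)} (hS : S.Nonempty) (u : ZMod p) :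
    ∃ x ∈ S, ∃ ε : ZMod p, (ε = 1 ∨ ε = -1) ∧
      dihedralSmaller p (((S.image fun y => (ε * u * (y - x)).val).sort (· ≤ ·))) = false := by
  classical
  have hne : (S ×ˢ ({1, -1} : Finset (ZMod p))).Nonempty := hS.product ⟨1, by simp⟩
  obtain ⟨⟨x, ε⟩, hmem, hmin⟩ := Finset.exists_min_image (S ×ˢ ({1, -1} : Finset (ZMod p)))
    (fun q => maskOf (((S.image fun y => (q.2 * u * (y - q.1)).val).sort (· ≤ ·)))) hne
  simp only [Finset.mem_product, mem_insert, mem_singleton] at hmem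
  refine ⟨x, hmem.1, ε, hmem.2, ?_⟩
  rw [dihedralSmaller, List.any_eq_false]
  intro v hv
  obtain ⟨y, hy, rfl⟩ := mem_valShape.1 hv
  have h1 := hmin (y, ε) (Finset.mem_product.2 ⟨hy, by rw [mem_insert, mem_singleton]; exact hmem.2⟩)
  have hnegε : -ε = 1 ∨ -ε = -1 := by
    rcases hmem.2 with h | h
    · exact Or.inr (by rw [h])
    · exact Or.inl (by rw [h, neg_neg])
  have h2 := hmin (y, -ε) (Finset.mem_product.2 ⟨hy, by rw [mem_insert, mem_singleton]; exact hnegε⟩)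
  simp only at h1 h2
  rw [rebaseMask_valShape, reflectMask_valShape, show -(ε * u) = -ε * u by ring]
  simp only [Bool.or_eq_true, Nat.blt_eq, not_or, not_lt]
  exact ⟨h1, h2⟩

/-! ## §3 A progression of difference `d` is one of difference `−d` -/

/-- `IsAP X d → IsAP X (−d)` (read the progression backwards). [cite: Nathanson1996, §2.5] -/
theorem IsAP.neg_diff {G : Type*} [AddCommGroup G] [DecidableEq G] {X : Finset G} {d : G} (h : IsAP X d) : IsAP X (-d) := by
  obtain ⟨a, ha⟩ := h
  rcases Nat.eq_zero_or_pos #X with h0 | hpos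
  · refine ⟨a, ?_⟩
    rw [h0, apFinset_zero]; rwa [h0, apFinset_zero] at ha
  · exact ⟨a + (#X - 1) • d, by rw [← Isoperimetric.apFinset_eq_apFinset_neg a d hpos]; exact ha⟩

/-! ## §4 The law with rows up to symmetry -/

/-- **Slack-2 law, cases A and B′ by rows up to the dihedral symmetry of the free shape.**  As `slack_two_caseC_of_rows`, but each row may instead certify
that the shape is not the minimal-mask representative of its orbit (`dihedralSmaller p Q = true`): the soundness theorem `caseADeadQ'_false_of_isAP`
is applied at the base point `β₀ ∈ Bᵢ` and the sign of `d` given by `exists_dihedralSmaller_false`. [cite: CohnKleinbergSzegedyUmans2005, Def. 5.1]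
[cite: Vosper1956, main theorem; Nathanson1996, Thm 2.7] -/
theorem slack_two_caseC_of_rowsQ {A B C : Fin 2 → Finset (ZMod p)} (hS : IsSTPP A B C)
    (hA : ∀ k, (A k).Nonempty) (hB : ∀ k, (B k).Nonempty) (hC : ∀ k, (C k).Nonempty) (i i₀ : Fin 2) (hii : i₀ ≠ i)
    {a b c L z a₀ b₀ c₀ vol : ℕ} (ha : #(A i) = a) (hb : #(B i) = b) (hc : #(C i) = c) (ha₀ : #(A i₀) = a₀) (hb₀ : #(B i₀) = b₀)
    (hc₀ : #(C i₀) = c₀) (hL : b₀ * c₀ = L) (hz : a₀ * c₀ = z) (hvol : a * b * c = vol) (hslack : z + b + vol + a + L = p)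
    (h2a : 2 ≤ a) (h2b : 2 ≤ b) (h2z : 2 ≤ z) (h2L : 2 ≤ L)
    (rowsA : ∀ Q ∈ qShapes p b 0 ((p - 1).choose (b - 1)), dihedralSmaller p Q = true ∨ caseADeadQ' p a c L z a₀ b₀ c₀ Q = true)
    (rowsB : ∀ Q ∈ qShapes p a 0 ((p - 1).choose (a - 1)), dihedralSmaller p Q = true ∨ caseADeadQ' p b c z L b₀ a₀ c₀ Q = true) :
    #((A i).image (fun x => (0 : ZMod p) - x) + DU B C (univ.erase i)) = a + L ∧
      #((B i).image (fun x => (0 : ZMod p) - x) + DU A C (univ.erase i)) = b + z ∧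
      (((A i) ×ˢ ((B i) ×ˢ (C i))).image fun q : ZMod p × ZMod p × ZMod p => (0 : ZMod p) + q.2.2 - q.1 - q.2.1) ∪
          ((A i).image (fun x => (0 : ZMod p) - x) + DU B C (univ.erase i)) ∪
          ((B i).image (fun x => (0 : ZMod p) - x) + DU A C (univ.erase i)) = univ := by
  have hI : (univ : Finset (Fin 2)).erase i = {i₀} := by
    fin_cases i <;> fin_cases i₀ <;> first | exact absurd rfl hii | decide
  have hIne : ((univ : Finset (Fin 2)).erase i).Nonempty := by rw [hI]; exact singleton_nonempty _
  have hvol' : #(A i) * #(B i) * #(C i) = vol := by rw [ha, hb, hc, hvol]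
  have hz' : ∑ k ∈ univ.erase i, #(A k) * #(C k) = z := by rw [hI, sum_singleton, ha₀, hc₀, hz]
  have hL' : ∑ k ∈ univ.erase i, #(B k) * #(C k) = L := by rw [hI, sum_singleton, hb₀, hc₀, hL]
  -- generic step: from `IsAP X d`, `IsAP Y d` (the pair of block `i` in an STPP family `(A', B', C')`) and rows over the free shape of `B' i`
  rcases slack_two_shapes hS hA hB hC i hIne ha hb hvol' hz' hL' hslack h2a h2b h2z h2L with
    ⟨d, hd, hAP, hYAP, -, -⟩ | ⟨e, he, hBP, hZAP, -, -⟩ | h3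
  · exfalso
    obtain ⟨β₀, hβ₀, ε, hε, hmin⟩ := exists_dihedralSmaller_false (hB i) d⁻¹
    have hεd : (ε * d) ≠ 0 := mul_ne_zero (by rcases hε with rfl | rfl <;> simp) hd
    have hAP' : IsAP (A i) (ε * d) := by
      rcases hε with rfl | rfl
      · rwa [one_mul]
      · rw [neg_one_mul]; exact IsAP.neg_diff hAP
    have hYAP' : IsAP (DU B C (univ.erase i)) (ε * d) := by
      rcases hε with rfl | rfl
      · rwa [one_mul]
      · rw [neg_one_mul]; exact IsAP.neg_diff hYAP
    have hinv : (ε * d)⁻¹ = ε * d⁻¹ := by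
      rcases hε with rfl | rfl
      · rw [one_mul, one_mul]
      · rw [neg_one_mul, neg_one_mul, inv_neg]
    have key := caseADeadQ'_false_of_isAP hS hA hB hC i i₀ hii ha hc ha₀ hb₀ hc₀ hL hz (by omega) hεd hAP' hYAP' hβ₀
    rw [hinv] at key
    have hu0 : ε * d⁻¹ ≠ 0 := by rw [← hinv]; exact inv_ne_zero hεd
    rcases rowsA _ (valShape_mem_qShapes hu0 hβ₀ hb) with h | h
    · rw [hmin] at h; exact Bool.noConfusion h
    · rw [key] at h; exact Bool.noConfusion h
  · exfalso
    have hS' : IsSTPP B A C := STPP222SqNeg.isSTPP_swapBC (stpp_rotate hS)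
    obtain ⟨α₀, hα₀, ε, hε, hmin⟩ := exists_dihedralSmaller_false (hA i) e⁻¹
    have hεe : (ε * e) ≠ 0 := mul_ne_zero (by rcases hε with rfl | rfl <;> simp) he
    have hBP' : IsAP (B i) (ε * e) := by
      rcases hε with rfl | rfl
      · rwa [one_mul]
      · rw [neg_one_mul]; exact IsAP.neg_diff hBP
    have hZAP' : IsAP (DU A C (univ.erase i)) (ε * e) := by
      rcases hε with rfl | rfl
      · rwa [one_mul]
      · rw [neg_one_mul]; exact IsAP.neg_diff hZAP
    have hinv : (ε * e)⁻¹ = ε * e⁻¹ := by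
      rcases hε with rfl | rfl
      · rw [one_mul, one_mul]
      · rw [neg_one_mul, neg_one_mul, inv_neg]
    have key := caseADeadQ'_false_of_isAP hS' hB hA hC i i₀ hii hb hc hb₀ ha₀ hc₀ hz hL (by omega) hεe hBP' hZAP' hα₀
    rw [hinv] at key
    have hu0 : ε * e⁻¹ ≠ 0 := by rw [← hinv]; exact inv_ne_zero hεe
    rcases rowsB _ (valShape_mem_qShapes hu0 hα₀ ha) with h | h
    · rw [hmin] at h; exact Bool.noConfusion h
    · rw [key] at h; exact Bool.noConfusion h
  · exact h3

/-! ## §5 Glue for chunked row files -/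

/-- Index-range chunks of `qShapes` concatenate: rows on `[lo, mid)` and `[mid, hi)` give rows on `[lo, hi)`. [folklore] -/
theorem forall_qShapes_append {p b lo mid hi : ℕ} (h1 : lo ≤ mid) (h2 : mid ≤ hi) {P : List ℕ → Prop}
    (hlo : ∀ Q ∈ qShapes p b lo mid, P Q) (hhi : ∀ Q ∈ qShapes p b mid hi, P Q) : ∀ Q ∈ qShapes p b lo hi, P Q := by
  intro Q hQ
  unfold qShapes at hQ hlo hhi
  set l := ((List.range' 1 (p - 1)).sublistsLen (b - 1)).map fun q => 0 :: q
  have hsplit : (l.drop lo).take (hi - lo) = (l.drop lo).take (mid - lo) ++ (l.drop mid).take (hi - mid) := by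
    rw [show hi - lo = (mid - lo) + (hi - mid) by omega, List.take_add, List.drop_drop, show lo + (mid - lo) = mid by omega]
  rw [hsplit, List.mem_append] at hQ
  exact hQ.elim (hlo Q) (hhi Q)

/-- Generic chunk glue: rows on `(l.drop lo).take n` and on `l.drop (lo + n)` give rows on `l.drop lo`. [folklore] -/
theorem forall_drop_of_take_drop {α : Type*} (l : List α) (lo n : ℕ) {P : α → Prop}
    (h1 : ∀ x ∈ (l.drop lo).take n, P x) (h2 : ∀ x ∈ l.drop (lo + n), P x) : ∀ x ∈ l.drop lo, P x := by
  intro x hx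
  rw [← List.take_append_drop n (l.drop lo), List.mem_append, List.drop_drop] at hx
  exact hx.elim (h1 x) (h2 x)

/-- From a kernel row `(qShapes …).all (fun Q => dihedralSmaller p Q || dead Q) = true` to the hypothesis form of `slack_two_caseC_of_rowsQ`. [folklore] -/
theorem rowsQ_of_all {p b lo hi : ℕ} {dead : List ℕ → Bool}
    (h : ((qShapes p b lo hi).all fun Q => dihedralSmaller p Q || dead Q) = true) :
    ∀ Q ∈ qShapes p b lo hi, dihedralSmaller p Q = true ∨ dead Q = true := by
  intro Q hQ
  have := List.all_eq_true.1 h Q hQ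
  rwa [Bool.or_eq_true] at this

end Summit.MatrixMultiplication.OmegaCensus.CubeNB.S2
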